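import Literature.MathematicalPhysics.QuantumFieldTheory.StrongCouplingTorusSystem
import Literature.MathematicalPhysics.QuantumFieldTheory.StrongCouplingActivities
import Literature.MathematicalPhysics.QuantumFieldTheory.StrongCouplingClustering
import HarnessLib

/-!
# Crux `NT` (stmt-QuantumFields-19353), strong-coupling rung `MirrorFloorSU2`: lattice-symmetry invariance of Haar
# integrals of plaquette products (relabelling)

Helper file of the fleet lead prover of crux `NT` (unit `ym-spine-19353-p1`, g17).  The clause-(i) twin `MirrorFloorSU2` of
`Cruxes/NT/Lines/strong_coupling_rung.lean` needs the Haar integrals `κ(T) = ∫ ∏_{f ∈ T} (Re tr ρ(U_f) − m) dU` of the THREE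
ten-face tubes `T_{ab} = ∂([−1,1]₀ × [0,1]_a × [0,1]_b)`, `{a,b} ⊂ {1,2,3}` (nine of the 36 plaquette pairs (p at e₀, s at −e₀)
are completed by one of them; `κ = 2⁻⁸` each for `SU(2)`), while the tree computes ONE box, `S28OneBitBox.boxIntegral_plaquetteObs`
for `∂([0,2]₀ × [0,1]₁ × [0,1]₂) = T₁₂ + e₀`.  The three tubes are images of that box under lattice symmetries (a translation,
composed with a permutation of the coordinate axes for `T₁₃`, `T₂₃`), and the Haar product is invariant under every injective
relabelling of the bonds (`integral_comp_eq_of_dependsOn_injOn`).  This file types the transport, for every `d`, `G`, `ρ`, `m`: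

* `plaquette_relabel` — for an additive `A : ℤᵈ → ℤᵈ` mapping unit vectors to unit vectors, `A eᵢ = e_{σ i}`, and a shift `v`,
  the plaquette holonomies of the relabelled configuration `e ↦ U (A e.1 + v, σ e.2)` are `U_{(A x + v; σ i, σ j)}`;
* `measurable_prodCentred'`, `dependsOn_prodCentred'` — bookkeeping for products of centred plaquette functions;
* **`integral_prodCentred_relabel`** — `∫ ∏_{q ∈ B} (Re tr ρ(U_{(A q.x + v; σ i_q, σ j_q)}) − m) dU = ∫ ∏_{q ∈ B} (Re tr ρ(U_q) − m) dU`
  for every finite family `B`, whenever the bond map `e ↦ (A e.1 + v, σ e.2)` is injective;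
* `integral_prodCentred_shift` — the translation case (`A = id`, `σ = id`).

HONEST FRAMING: Haar-measure bookkeeping; nothing about NT or the gap.  [folklore]
-/

set_option autoImplicit false

noncomputable section

open MeasureTheory
open Literature.MathematicalPhysics.QuantumLattice (ZdPlaquette plaquetteEdges)
open Literature.MathematicalPhysics.QuantumFieldTheory

namespace Summit.QuantumFields.YangMills.Cruxes.NT.StrongCouplingRung

variable {d : ℕ} {G : Type*} [Group G]

/-- **Plaquettes of a relabelled configuration.**  If `A` is additive with `A eᵢ = e_{σ i}` then the plaquette holonomy of
`e ↦ U (A e.1 + v, σ e.2)` at `(x; i, j)` is `U_{(A x + v; σ i, σ j)}`. [folklore] -/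
theorem plaquette_relabel (U : ZdGaugeConfig d G) {A : Literature.Probability.LatticeModels.Site d →
      Literature.Probability.LatticeModels.Site d} (hA : ∀ x y, A (x + y) = A x + A y) {σ : Fin d → Fin d}
    (hAσ : ∀ i, A (Pi.single i 1) = Pi.single (σ i) 1) (v x : Literature.Probability.LatticeModels.Site d) (i j : Fin d) :
    ZdGaugeConfig.plaquette (fun e : ZdEdge d => U (A e.1 + v, σ e.2)) x i j = U.plaquette (A x + v) (σ i) (σ j) := by
  simp only [ZdGaugeConfig.plaquette, hA, hAσ, add_right_comm]

section Haar

variable [TopologicalSpace G] [IsTopologicalGroup G] [CompactSpace G] [MeasurableSpace G] [BorelSpace G]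
  {N : ℕ} (ρ : G →* Matrix (Fin N) (Fin N) ℂ)

omit [CompactSpace G] in
/-- The centred product `U ↦ ∏_{q ∈ B} (Re tr ρ(U_q) − m)` is measurable. [folklore] -/
theorem measurable_prodCentred' (hρ : Continuous ρ) (B : Finset (ZdPlaquette d)) (m : ℝ) :
    Measurable fun U : ZdGaugeConfig d G => ∏ q ∈ B, ((ρ (U.plaquette q.1 q.2.1.1 q.2.1.2)).trace.re - m) :=
  Finset.measurable_prod _ fun _ _ => (measurable_trace_re_plaquette ρ hρ _ _ _).sub_const _

omit [TopologicalSpace G] [IsTopologicalGroup G] [CompactSpace G] [MeasurableSpace G] [BorelSpace G] in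
/-- The centred product depends only on the bonds of its plaquettes. [folklore] -/
theorem dependsOn_prodCentred' [DecidableEq (ZdEdge d)] (B : Finset (ZdPlaquette d)) (m : ℝ) :
    DependsOn (fun U : ZdGaugeConfig d G => ∏ q ∈ B, ((ρ (U.plaquette q.1 q.2.1.1 q.2.1.2)).trace.re - m))
      ((B.biUnion plaquetteEdges : Finset (ZdEdge d)) : Set (ZdEdge d)) := by
  intro U V h
  refine Finset.prod_congr rfl fun a ha => ?_
  have := ZdGaugeConfig.dependsOn_plaquette (G := G) a (x := U) (y := V) fun e he =>
    h e (Finset.mem_coe.2 (Finset.mem_biUnion.2 ⟨a, ha, Finset.mem_coe.1 he⟩))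
  simp only at this; rw [this]

/-- **Lattice-symmetry invariance of Haar integrals of plaquette products.**  For an additive `A : ℤᵈ → ℤᵈ` with
`A eᵢ = e_{σ i}`, a shift `v`, and the bond map `e ↦ (A e.1 + v, σ e.2)` injective,
`∫ ∏_{q ∈ B} (Re tr ρ(U_{(A q.x + v; σ i_q, σ j_q)}) − m) dU = ∫ ∏_{q ∈ B} (Re tr ρ(U_q) − m) dU`. [folklore] -/
theorem integral_prodCentred_relabel (hρ : Continuous ρ) (m : ℝ) (B : Finset (ZdPlaquette d))
    {A : Literature.Probability.LatticeModels.Site d → Literature.Probability.LatticeModels.Site d}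
    (hA : ∀ x y, A (x + y) = A x + A y) {σ : Fin d → Fin d} (hAσ : ∀ i, A (Pi.single i 1) = Pi.single (σ i) 1)
    (v : Literature.Probability.LatticeModels.Site d)
    (hinj : Function.Injective fun e : ZdEdge d => ((A e.1 + v, σ e.2) : ZdEdge d)) :
    ∫ U, ∏ q ∈ B, ((ρ (U.plaquette (A q.1 + v) (σ q.2.1.1) (σ q.2.1.2))).trace.re - m) ∂zdHaar d G =
      ∫ U, ∏ q ∈ B, ((ρ (U.plaquette q.1 q.2.1.1 q.2.1.2)).trace.re - m) ∂zdHaar d G := by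
  classical
  set Φ : ZdGaugeConfig d G → ℂ := fun U =>
    ((∏ q ∈ B, ((ρ (U.plaquette q.1 q.2.1.1 q.2.1.2)).trace.re - m) : ℝ) : ℂ) with hΦ
  have hΦm : Measurable Φ := Complex.measurable_ofReal.comp (measurable_prodCentred' ρ hρ B m)
  have hΦS : DependsOn Φ ((B.biUnion plaquetteEdges : Finset (ZdEdge d)) : Set (ZdEdge d)) := by
    intro U V h
    have := dependsOn_prodCentred' ρ B m (G := G) h
    simp only at this
    simp only [hΦ, this]
  have h := integral_comp_eq_of_dependsOn_injOn hΦm hΦS (f := fun e : ZdEdge d => ((A e.1 + v, σ e.2) : ZdEdge d))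
    hinj.injOn
  have hcomp : ∀ U : ZdGaugeConfig d G,
      Φ (U ∘ fun e : ZdEdge d => ((A e.1 + v, σ e.2) : ZdEdge d)) =
        ((∏ q ∈ B, ((ρ (U.plaquette (A q.1 + v) (σ q.2.1.1) (σ q.2.1.2))).trace.re - m) : ℝ) : ℂ) := by
    intro U
    simp only [hΦ, Function.comp_def]
    congr 1
    exact Finset.prod_congr rfl fun q _ => by rw [plaquette_relabel U hA hAσ v]
  simp only [hcomp] at h
  have h' := congrArg Complex.re h
  rw [hΦ, integral_complex_ofReal, integral_complex_ofReal, Complex.ofReal_re, Complex.ofReal_re] at h'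
  exact h'

/-- **Translation invariance** (the case `A = id`, `σ = id`):
`∫ ∏_{q ∈ B} (Re tr ρ(U_{q + v}) − m) dU = ∫ ∏_{q ∈ B} (Re tr ρ(U_q) − m) dU`. [folklore] -/
theorem integral_prodCentred_shift (hρ : Continuous ρ) (m : ℝ) (B : Finset (ZdPlaquette d))
    (v : Literature.Probability.LatticeModels.Site d) :
    ∫ U, ∏ q ∈ B, ((ρ (U.plaquette (q.1 + v) q.2.1.1 q.2.1.2)).trace.re - m) ∂zdHaar d G =
      ∫ U, ∏ q ∈ B, ((ρ (U.plaquette q.1 q.2.1.1 q.2.1.2)).trace.re - m) ∂zdHaar d G :=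
  integral_prodCentred_relabel ρ hρ m B (A := id) (fun _ _ => rfl) (σ := id) (fun _ => rfl) v
    fun e e' h => by
      simp only [id_eq, Prod.mk.injEq, add_left_inj] at h
      exact Prod.ext h.1 h.2

end Haar

end Summit.QuantumFields.YangMills.Cruxes.NT.StrongCouplingRung

end
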